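import Mathlib
import Summits.Ventures.PercRepro2.CrossAPrimeVMarkedRootRoute

/-!
# A three-route mark: the connectivity lemmas
(blind cell PercRepro2, p5 g41; S4 §2.4 (s) addendum 61 — part 1 of `CrossAPrimeVMarkedThreeRoute`)

The mark `v` has exactly the three edges `fa = {v, a₁}`, `fo = {v, o}`, `fb = {v, b}` (the diamond
with `v` of degree 3 and `K₄` are the 4-vertex instances).  With `σ` = `ω` with the three edges closed
and `O = {a₁ ↔ o in σ}`, `B = {a₁ ↔ b in σ}`, `W = {b ↔ o in σ}`:

  `a₁ ↔ v ⟺ fa ∨ (fo ∧ O) ∨ (fb ∧ B)`,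
  `a₁ ↔ o ⟺ O ∨ (fa ∧ fo) ∨ (fa ∧ fb ∧ W) ∨ (fo ∧ fb ∧ B)`,
  `a₁ ↔ b ⟺ B ∨ (fa ∧ fb) ∨ (fa ∧ fo ∧ W) ∨ (fo ∧ fb ∧ O)`

(`conn_threeRoute_v / _o / _b`), by the eight coin cases, each reduced to the two-route lemmas of
`CrossAPrimeVMarkedTwoRouteConn` / `CrossAPrimeVMarkedRootRoute`.  Own work; standard axioms.
-/

namespace Summit.Ventures.PercRepro2

open CrossAPrimeVMarked CrossAPrimeIsolatedFlip OneEdge CrossAPrimeVMarkedTwoRoute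
  CrossAPrimeVMarkedRootRoute

namespace CrossAPrimeVMarkedThreeRoute

variable {V : Type*} {E : Type*} [Fintype E] [DecidableEq E] [Fintype V] [DecidableEq V]
  {R : Type*} [Field R] [LinearOrder R] [IsStrictOrderedRing R]
variable {ends : E → Sym2 V}

section Close

variable (fa fo fb : E)

omit [Fintype E] [Fintype V] [DecidableEq V] in
/-- Closing the three edges leaves the other edges alone. -/
lemma closeThree_apply_of_ne (ω : Config E) {e : E} (ha : e ≠ fa) (ho : e ≠ fo) (hb : e ≠ fb) :
    Function.update (Function.update (Function.update ω fa false) fo false) fb false e = ω e := by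
  simp [Function.update_of_ne ha, Function.update_of_ne ho, Function.update_of_ne hb]

omit [Fintype E] [Fintype V] [DecidableEq V] in
/-- The three closed edges. -/
lemma closeThree_apply (ω : Config E) (hao : fa ≠ fo) (hab : fa ≠ fb) (hob : fo ≠ fb) :
    Function.update (Function.update (Function.update ω fa false) fo false) fb false fa = false ∧
      Function.update (Function.update (Function.update ω fa false) fo false) fb false fo = false ∧
      Function.update (Function.update (Function.update ω fa false) fo false) fb false fb = false := by
  refine ⟨?_, ?_, ?_⟩
  · simp [Function.update_of_ne hab, Function.update_of_ne hao]
  · simp [Function.update_of_ne hob]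
  · simp

omit [Fintype E] [Fintype V] [DecidableEq V] in
/-- Closing one edge is monotone. -/
lemma update_false_mono' (f : E) {ω ω' : Config E} (h : ω ≤ ω') :
    Function.update ω f false ≤ Function.update ω' f false := by
  intro e
  by_cases he : e = f
  · subst he
    simp
  · rw [Function.update_of_ne he, Function.update_of_ne he]
    exact h e

omit [Fintype E] [Fintype V] [DecidableEq V] in
/-- Closing the three edges is monotone. -/
lemma closeThree_mono {ω ω' : Config E} (h : ω ≤ ω') :
    Function.update (Function.update (Function.update ω fa false) fo false) fb false ≤
      Function.update (Function.update (Function.update ω' fa false) fo false) fb false :=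
  update_false_mono' fb (update_false_mono' fo (update_false_mono' fa h))

omit [Fintype E] [Fintype V] [DecidableEq V] in
/-- Two configurations agreeing off `{fa, fo, fb}` agree after closing the three edges. -/
lemma closeThree_eq_of_agree {ω ω' : Config E}
    (h : ∀ e ∈ ({fa, fo, fb} : Set E)ᶜ, ω e = ω' e) :
    Function.update (Function.update (Function.update ω fa false) fo false) fb false =
      Function.update (Function.update (Function.update ω' fa false) fo false) fb false := by
  funext e
  by_cases hb : e = fb
  · subst hb; simp
  · rw [Function.update_of_ne hb, Function.update_of_ne hb]
    by_cases ho : e = fo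
    · subst ho; simp
    · rw [Function.update_of_ne ho, Function.update_of_ne ho]
      by_cases ha : e = fa
      · subst ha; simp
      · rw [Function.update_of_ne ha, Function.update_of_ne ha]
        exact h e (by simp [ha, ho, hb])

omit [Fintype E] [Fintype V] [DecidableEq V] in
/-- An event of the form `{ω | σ ∈ A}` (`σ` = `ω` with the three edges closed) is determined by the
other edges. -/
lemma dependsOn_closeThree (A : Set (Config E)) :
    DependsOn (· ∈ {ω : Config E |
        Function.update (Function.update (Function.update ω fa false) fo false) fb false ∈ A})
      (({fa, fo, fb} : Set E)ᶜ) := by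
  intro ω ω' h
  simp only [Set.mem_setOf_eq]
  rw [closeThree_eq_of_agree fa fo fb h]

omit [Fintype E] [Fintype V] [DecidableEq V] in
/-- Reconstruction of `ω` from `σ` by the three coin values. -/
lemma eq_update_closeThree (ω : Config E) (hao : fa ≠ fo) (hab : fa ≠ fb) (hob : fo ≠ fb) :
    ω = Function.update (Function.update (Function.update
      (Function.update (Function.update (Function.update ω fa false) fo false) fb false)
        fa (ω fa)) fo (ω fo)) fb (ω fb) := by
  funext e
  by_cases hb : e = fb
  · subst hb; simp
  · rw [Function.update_of_ne hb]
    by_cases ho : e = fo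
    · subst ho; simp
    · rw [Function.update_of_ne ho]
      by_cases ha : e = fa
      · subst ha; simp
      · rw [Function.update_of_ne ha, closeThree_apply_of_ne fa fo fb ω ha ho hb]

end Close

section Conn

variable {fa fo fb : E} {a₁ v o b : V}

omit [Fintype E] [Fintype V] [DecidableEq V] in
/-- The closed-routes configuration has `v` isolated. -/
lemma closeThree_isolated (hv : ∀ e, v ∈ ends e → e = fa ∨ e = fo ∨ e = fb) (hao : fa ≠ fo)
    (hab : fa ≠ fb) (hob : fo ≠ fb) (ω : Config E) :
    ∀ e, v ∈ ends e →
      Function.update (Function.update (Function.update ω fa false) fo false) fb false e = false := by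
  intro e he
  have C := closeThree_apply fa fo fb ω hao hab hob
  rcases hv e he with h | h | h <;> rw [h]
  · exact C.1
  · exact C.2.1
  · exact C.2.2

omit [Fintype E] [Fintype V] [DecidableEq V] in
/-- The eight reconstructions of `ω` from `σ` (the three edges closed) by the coin values. -/
lemma eq_of_coins3 (hao : fa ≠ fo) (hab : fa ≠ fb) (hob : fo ≠ fb) (ω : Config E) :
    let σ := Function.update (Function.update (Function.update ω fa false) fo false) fb false
    (ω fa = false → ω fo = false → ω fb = false → ω = σ) ∧
      (ω fa = true → ω fo = false → ω fb = false → ω = Function.update σ fa true) ∧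
      (ω fa = false → ω fo = true → ω fb = false → ω = Function.update σ fo true) ∧
      (ω fa = false → ω fo = false → ω fb = true → ω = Function.update σ fb true) ∧
      (ω fa = true → ω fo = true → ω fb = false →
        ω = Function.update (Function.update σ fa true) fo true) ∧
      (ω fa = true → ω fo = false → ω fb = true →
        ω = Function.update (Function.update σ fa true) fb true) ∧
      (ω fa = false → ω fo = true → ω fb = true →
        ω = Function.update (Function.update σ fo true) fb true) ∧
      (ω fa = true → ω fo = true → ω fb = true →
        ω = Function.update (Function.update (Function.update σ fa true) fo true) fb true) := by
  intro σ
  have hrec := eq_update_closeThree fa fo fb ω hao hab hob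
  have C := closeThree_apply fa fo fb ω hao hab hob
  -- dropping a closed update
  have da : Function.update σ fa false = σ := Function.update_eq_self_iff.2 C.1.symm
  have do' : ∀ x, Function.update (Function.update σ fa x) fo false = Function.update σ fa x :=
    fun x => Function.update_eq_self_iff.2 (by rw [Function.update_of_ne hao.symm]; exact C.2.1.symm)
  have db : ∀ x y, Function.update (Function.update (Function.update σ fa x) fo y) fb false =
      Function.update (Function.update σ fa x) fo y := fun x y =>
    Function.update_eq_self_iff.2
      (by rw [Function.update_of_ne hob.symm, Function.update_of_ne hab.symm]; exact C.2.2.symm)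
  refine ⟨fun h1 h2 h3 => ?_, fun h1 h2 h3 => ?_, fun h1 h2 h3 => ?_, fun h1 h2 h3 => ?_,
    fun h1 h2 h3 => ?_, fun h1 h2 h3 => ?_, fun h1 h2 h3 => ?_, fun h1 h2 h3 => ?_⟩ <;>
    rw [h1, h2, h3] at hrec
  · rw [db, do', da] at hrec; exact hrec
  · rw [db, do'] at hrec; exact hrec
  · rw [db, da] at hrec; exact hrec
  · rw [do', da] at hrec; exact hrec
  · rw [db] at hrec; exact hrec
  · rw [do'] at hrec; exact hrec
  · rw [da] at hrec; exact hrec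
  · exact hrec

omit [Fintype E] [Fintype V] [DecidableEq V] in
/-- All three edges open: `a₁` reaches `o`, `b` and `v`. -/
lemma conn_all_open {σ : Config E} (hfa : ends fa = s(v, a₁)) (hfo : ends fo = s(v, o))
    (hfb : ends fb = s(v, b)) (hiso : ∀ e, v ∈ ends e → σ e = false) (hav : a₁ ≠ v) (hov : o ≠ v)
    (hbv : b ≠ v) :
    Conn ends (Function.update (Function.update (Function.update σ fa true) fo true) fb true) a₁ o ∧
      Conn ends (Function.update (Function.update (Function.update σ fa true) fo true) fb true) a₁ b ∧
      Conn ends (Function.update (Function.update (Function.update σ fa true) fo true) fb true) a₁ v := by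
  have T := conn_both_open_root hfa hfo hiso hav hbv hov
  set σ₂ := Function.update (Function.update σ fa true) fo true with hσ₂
  refine ⟨?_, ?_, ?_⟩
  · rw [conn_update_true_iff hfb σ₂ a₁ o]
    exact Or.inl T.2.1
  · rw [conn_update_true_iff hfb σ₂ a₁ b]
    exact Or.inr (Or.inl ⟨T.2.2, conn_refl ends σ₂ b⟩)
  · rw [conn_update_true_iff hfb σ₂ a₁ v]
    exact Or.inl T.2.2

omit [Fintype E] [Fintype V] [DecidableEq V] in
/-- **The three-route mark, the mark `v`**: `a₁ ↔ v ⟺ fa ∨ (fo ∧ O) ∨ (fb ∧ B)`. -/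
theorem conn_threeRoute_v (hfa : ends fa = s(v, a₁)) (hfo : ends fo = s(v, o))
    (hfb : ends fb = s(v, b)) (hv : ∀ e, v ∈ ends e → e = fa ∨ e = fo ∨ e = fb) (hao : fa ≠ fo)
    (hab : fa ≠ fb) (hob : fo ≠ fb) (hav : a₁ ≠ v) (hov : o ≠ v) (hbv : b ≠ v) (ω : Config E) :
    Conn ends ω a₁ v ↔
      (ω fa = true ∨ (ω fo = true ∧ Conn ends (Function.update (Function.update (Function.update ω fa false) fo false) fb false) a₁ o)) ∨
        (ω fb = true ∧ Conn ends (Function.update (Function.update (Function.update ω fa false) fo false) fb false) a₁ b) := by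
  have hiso := closeThree_isolated hv hao hab hob ω
  have R := eq_of_coins3 hao hab hob ω
  dsimp only at R
  have Pa := conn_pendant_update hfa hiso hav
  have Po := conn_pendant_update hfo hiso hov
  have Pb := conn_pendant_update hfb hiso hbv
  cases ha : ω fa <;> cases ho : ω fo <;> cases hb : ω fb
  · conv_lhs => rw [R.1 ha ho hb]
    simp only [Bool.false_eq_true, false_and, or_self, iff_false]
    exact fun h => hav (eq_of_conn_of_isolated hiso (conn_symm h))
  · simp only [Bool.false_eq_true, false_and, true_and, false_or]
    conv_lhs => rw [R.2.2.2.1 ha ho hb]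
    exact ⟨fun h => conn_symm ((Pb.2 a₁ hav).1 (conn_symm h)),
      fun h => conn_symm ((Pb.2 a₁ hav).2 (conn_symm h))⟩
  · simp only [Bool.false_eq_true, false_and, true_and, false_or, or_false]
    conv_lhs => rw [R.2.2.1 ha ho hb]
    exact ⟨fun h => conn_symm ((Po.2 a₁ hav).1 (conn_symm h)),
      fun h => conn_symm ((Po.2 a₁ hav).2 (conn_symm h))⟩
  · simp only [Bool.false_eq_true, true_and, false_or]
    conv_lhs => rw [R.2.2.2.2.2.2.1 ha ho hb]
    exact (conn_both_open hfo hfb hiso hav hov hbv).2.2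
  · simp only [true_or, iff_true]
    rw [R.2.1 ha ho hb]
    exact conn_symm ((Pa.2 a₁ hav).2 (conn_refl ends _ a₁))
  · simp only [true_or, iff_true]
    rw [R.2.2.2.2.2.1 ha ho hb]
    exact (conn_both_open_root hfa hfb hiso hav hov hbv).2.2
  · simp only [true_or, iff_true]
    rw [R.2.2.2.2.1 ha ho hb]
    exact (conn_both_open_root hfa hfo hiso hav hbv hov).2.2
  · simp only [true_or, iff_true]
    rw [R.2.2.2.2.2.2.2 ha ho hb]
    exact (conn_all_open hfa hfo hfb hiso hav hov hbv).2.2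

omit [Fintype E] [Fintype V] [DecidableEq V] in
/-- **The three-route mark, the mark `o`**: `a₁ ↔ o ⟺ O ∨ (fa ∧ fo) ∨ (fa ∧ fb ∧ W) ∨ (fo ∧ fb ∧ B)`. -/
theorem conn_threeRoute_o (hfa : ends fa = s(v, a₁)) (hfo : ends fo = s(v, o))
    (hfb : ends fb = s(v, b)) (hv : ∀ e, v ∈ ends e → e = fa ∨ e = fo ∨ e = fb) (hao : fa ≠ fo)
    (hab : fa ≠ fb) (hob : fo ≠ fb) (hav : a₁ ≠ v) (hov : o ≠ v) (hbv : b ≠ v) (ω : Config E) :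
    Conn ends ω a₁ o ↔
      ((Conn ends (Function.update (Function.update (Function.update ω fa false) fo false) fb false) a₁ o ∨ (ω fa = true ∧ ω fo = true)) ∨
        ((ω fa = true ∧ ω fb = true) ∧ Conn ends (Function.update (Function.update (Function.update ω fa false) fo false) fb false) b o)) ∨
        ((ω fo = true ∧ ω fb = true) ∧ Conn ends (Function.update (Function.update (Function.update ω fa false) fo false) fb false) a₁ b) := by
  have hiso := closeThree_isolated hv hao hab hob ω
  have R := eq_of_coins3 hao hab hob ω
  dsimp only at R
  have Pa := conn_pendant_update hfa hiso hav
  have Po := conn_pendant_update hfo hiso hov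
  have Pb := conn_pendant_update hfb hiso hbv
  cases ha : ω fa <;> cases ho : ω fo <;> cases hb : ω fb
  · simp only [Bool.false_eq_true, false_and, and_false, or_false]
    conv_lhs => rw [R.1 ha ho hb]
  · simp only [Bool.false_eq_true, false_and, and_false, or_false]
    conv_lhs => rw [R.2.2.2.1 ha ho hb]
    exact Pb.1 a₁ o hav hov
  · simp only [Bool.false_eq_true, false_and, and_false, or_false, and_true]
    conv_lhs => rw [R.2.2.1 ha ho hb]
    exact Po.1 a₁ o hav hov
  · simp only [Bool.false_eq_true, false_and, or_false, true_and]
    conv_lhs => rw [R.2.2.2.2.2.2.1 ha ho hb]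
    exact (conn_both_open hfo hfb hiso hav hov hbv).1
  · simp only [Bool.false_eq_true, and_false, false_and, or_false]
    conv_lhs => rw [R.2.1 ha ho hb]
    exact Pa.1 a₁ o hav hov
  · simp only [Bool.false_eq_true, and_false, false_and, or_false, true_and]
    conv_lhs => rw [R.2.2.2.2.2.1 ha ho hb]
    exact (conn_both_open_root hfa hfb hiso hav hov hbv).1
  · simp only [and_self, true_or, or_true, iff_true]
    rw [R.2.2.2.2.1 ha ho hb]
    exact (conn_both_open_root hfa hfo hiso hav hbv hov).2.1
  · simp only [and_self, true_or, or_true, iff_true]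
    rw [R.2.2.2.2.2.2.2 ha ho hb]
    exact (conn_all_open hfa hfo hfb hiso hav hov hbv).1

omit [Fintype E] [Fintype V] [DecidableEq V] in
/-- **The three-route mark, the mark `b`**: `a₁ ↔ b ⟺ B ∨ (fa ∧ fb) ∨ (fa ∧ fo ∧ W) ∨ (fo ∧ fb ∧ O)`. -/
theorem conn_threeRoute_b (hfa : ends fa = s(v, a₁)) (hfo : ends fo = s(v, o))
    (hfb : ends fb = s(v, b)) (hv : ∀ e, v ∈ ends e → e = fa ∨ e = fo ∨ e = fb) (hao : fa ≠ fo)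
    (hab : fa ≠ fb) (hob : fo ≠ fb) (hav : a₁ ≠ v) (hov : o ≠ v) (hbv : b ≠ v) (ω : Config E) :
    Conn ends ω a₁ b ↔
      ((Conn ends (Function.update (Function.update (Function.update ω fa false) fo false) fb false) a₁ b ∨ (ω fa = true ∧ ω fb = true)) ∨
        ((ω fa = true ∧ ω fo = true) ∧ Conn ends (Function.update (Function.update (Function.update ω fa false) fo false) fb false) b o)) ∨
        ((ω fo = true ∧ ω fb = true) ∧ Conn ends (Function.update (Function.update (Function.update ω fa false) fo false) fb false) a₁ o) := by
  have hiso := closeThree_isolated hv hao hab hob ω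
  have R := eq_of_coins3 hao hab hob ω
  dsimp only at R
  have Pa := conn_pendant_update hfa hiso hav
  have Po := conn_pendant_update hfo hiso hov
  have Pb := conn_pendant_update hfb hiso hbv
  cases ha : ω fa <;> cases ho : ω fo <;> cases hb : ω fb
  · simp only [Bool.false_eq_true, false_and, and_false, or_false]
    conv_lhs => rw [R.1 ha ho hb]
  · simp only [Bool.false_eq_true, false_and, and_false, or_false, and_true]
    conv_lhs => rw [R.2.2.2.1 ha ho hb]
    exact Pb.1 a₁ b hav hbv
  · simp only [Bool.false_eq_true, false_and, and_false, or_false]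
    conv_lhs => rw [R.2.2.1 ha ho hb]
    exact Po.1 a₁ b hav hbv
  · simp only [Bool.false_eq_true, false_and, or_false, true_and]
    conv_lhs => rw [R.2.2.2.2.2.2.1 ha ho hb]
    exact (conn_both_open hfo hfb hiso hav hov hbv).2.1
  · simp only [Bool.false_eq_true, and_false, false_and, or_false]
    conv_lhs => rw [R.2.1 ha ho hb]
    exact Pa.1 a₁ b hav hbv
  · simp only [and_self, true_or, or_true, iff_true]
    rw [R.2.2.2.2.2.1 ha ho hb]
    exact (conn_both_open_root hfa hfb hiso hav hov hbv).2.1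
  · simp only [Bool.false_eq_true, and_false, false_and, or_false, true_and]
    conv_lhs => rw [R.2.2.2.2.1 ha ho hb]
    have T := (conn_both_open_root hfa hfo hiso hav hbv hov).1
    rw [T]
    exact or_congr_right ⟨conn_symm, conn_symm⟩
  · simp only [and_self, true_or, or_true, iff_true]
    rw [R.2.2.2.2.2.2.2 ha ho hb]
    exact (conn_all_open hfa hfo hfb hiso hav hov hbv).2.1

end Conn

end CrossAPrimeVMarkedThreeRoute

end Summit.Ventures.PercRepro2
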